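/-
Copyright (c) 2026 the pub-hodgecm-mathlib formalisation cell (harness21).  Prover seat hodgecm-mathlib-K2Liu-p13 (g0), Track B «K2-LIT»,
#184♮ = hLiu418 = `stmt-HodgeConjecture-24832`; Road I v3 organ U1-CT-ind STAGE 2 (Q2), census `K2/K2Liu-p13/g0/CENSUS-Q2-KlingenConstantTerm.K2Liu-p13-g0.md`
22b7515c9c43e994, file F2 (LEAD F0P6-plan (g13) «=» 08:56:51Z).
-/
import Summits.HodgeConjecture.HodgeConjecture.Theorems.K2LiuKlingenParabolicDefs   -- ★ F1 (p858813): `siegelFour`, `klingen`, `klingenLevi`, `nKlingen`, `weylXi`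
import HarnessLib

/-!
# Crux `HLiu418`, Road I v3, organ U1 stage 2 (Q2), file F2: THE TWO CELLS `U(J₄)(K) = P·Q ⊔ P·ξ·Q` OVER A FIELD, BY THE COLUMN TEST
# (`g ∈ P·Q ↔ (g e₀)₂ = (g e₀)₃ = 0`; otherwise `g ∈ P·ξ·Q`, `ξ = w₂ w₁`) — no BN-pair theory

Cell `hodgecm-mathlib`, crux item hLiu418 = `stmt-HodgeConjecture-24832`; squad K2 ∕ K2Liu; LEAD F0P6-plan (g13), co-dealer K2E5-plan (g6); prover K2Liu-p13 (g0).
THEOREMS ONLY (no `def`, no instance, no notation, no named-fact hypothesis, no `sorry`); lane `--supports stmt-HodgeConjecture-24832 --as helper` (count-neutral).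
Frame of ★ F1 `K2LiuKlingenParabolicDefs` (K2Liu-p03's `U(J₄)` letters): `P = siegelFour` (lower-left `2×2` block zero), `Q = klingen` (`g₁₀ = g₂₀ = g₃₀ = 0`), `ξ = weylXi = w₂ w₁`
(`ξ e₀ = e₂`), Siegel Levi `m(A) = leviElt A`, block unipotent `n(X) = nSiegelBlk` (★ `K2LiuDoubledUTwoTwoLevi`).

THE DOUBLE COSETS `P\U(J₄)∕Q` (= `W_P\W∕W_Q = {1, ξ}`, [Xiong2013 L.7.1] «`G_n = P Q ∪ P w Q`» at `n = 2`), proved by LINEAR ALGEBRA on the first column `c = g e₀` (an isotropic vector,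
§1 `isotropic_col_zero`):
* §2 **`mem_siegel_mul_klingen_iff`** (`K` a field): `(∃ p ∈ P, ∃ q ∈ Q, g = p q) ↔ g₂₀ = 0 ∧ g₃₀ = 0`.  (⇐) `p := m(A)` with `A ∈ GL₂(K)` of first column `(g₀₀, g₁₀) ≠ 0`; then
  `q := p⁻¹ g` fixes `e₀` (§1 `inv_mul_apply_col`: if the `j`-th column of `p` is the first column of `g` then `(p⁻¹g) e₀ = e_j`).  (⇒) the first column of `p q` is `q₀₀ · (p e₀)`.
* §3 **`exists_siegel_weylXi_klingen`**: `¬(g₂₀ = 0 ∧ g₃₀ = 0) → ∃ p ∈ P, ∃ q ∈ Q, g = p ξ q`.  Construction: `x := σ(g₃₀) g₀₀ + σ(g₂₀) g₁₀` satisfies `σ x = −x` BY ISOTROPY of `c`;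
  `p := m(A) · n(X)` with `X = (z 0; x −σz)` skew and `A ∈ GL₂(K)` chosen (two cases `g₂₀ ≠ 0` ∕ `g₂₀ = 0`) so that the THIRD column of `p` is `c`: `p e₂ = m(A)(z, x, 1, 0)ᵀ = c`; then
  `q := ξ⁻¹ p⁻¹ g` fixes `e₀` (`p⁻¹ g e₀ = e₂ = ξ e₀`).
* §4 **`not_col_zero_of_mem_siegel_weylXi_klingen`**: `g = p ξ q ⇒ ¬(g₂₀ = 0 ∧ g₃₀ = 0)` (the lower-right block of `p ∈ P` has a left inverse, so its first column
  `(p₂₂, p₃₂) ≠ 0`; `q₀₀ ≠ 0`), hence the two cells are DISJOINT and cover: **`siegel_klingen_dichotomy`**.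
These are the index sets of the two terms of the Q-constant term `E_Q = E^{(1)}(s+½; i^*f) + E^{(1)}(s−½; i^* M(ξ,s) f)` (files F4∕F5).
[Xiong2013, §7 Lemma 7.1], [GanTakeda2011SiegelWeil, §7.2 p. 23], [MoeglinWaldspurger1995, II.1.7], [Casselman1980, §3 (relative Bruhat decomposition)].
HONEST LABEL.  Count-neutral helper: `HC_CM` is proved only modulo the 7 printed citations (2 remaining named inputs: hLiu418 = `stmt-HodgeConjecture-24832`,
h413 = `stmt-HodgeConjecture-24833`) until rung 0 closes.
-/

set_option autoImplicit false
set_option linter.dupNamespace false -- the mandated namespace repeats `HodgeConjecture.HodgeConjecture`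

noncomputable section

open Matrix
open Literature.NumberTheory.Automorphic
open Summit.HodgeConjecture.HodgeConjecture.Cruxes.HLiu418.K2LiuDoubledUTwoTwoBorelFrame
open Summit.HodgeConjecture.HodgeConjecture.Cruxes.HLiu418.K2LiuDoubledUTwoTwoWeylCocycle
open Summit.HodgeConjecture.HodgeConjecture.Cruxes.HLiu418.K2LiuDoubledUTwoTwoLevi
open Summit.HodgeConjecture.HodgeConjecture.Cruxes.HLiu418.K2LiuKlingenParabolicDefs

namespace Summit.HodgeConjecture.HodgeConjecture.Cruxes.HLiu418.K2LiuKlingenBruhatTwoCells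

/-! ## §1 Column bookkeeping over a commutative ring -/

section Ring

variable {R : Type*} [CommRing R] {σ : R →+* R}

/-- **the first column of a unitary element is ISOTROPIC**: `σ(g₀₀) g₃₀ + σ(g₁₀) g₂₀ + σ(g₂₀) g₁₀ + σ(g₃₀) g₀₀ = 0` (entry `(0,0)` of `σ(g)ᵀ J₄ g = J₄`).
[cite: Xiong2013, §7 Lemma 7.1] [cite: Rogawski1990, §1.9] -/
theorem isotropic_col_zero (g : unitaryGroupOfForm σ ((StdForm.antidiagonal 4).over R)) :
    σ (((g : GL (Fin 4) R) : Matrix (Fin 4) (Fin 4) R) 0 0) * ((g : GL (Fin 4) R) : Matrix (Fin 4) (Fin 4) R) 3 0 +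
      σ (((g : GL (Fin 4) R) : Matrix (Fin 4) (Fin 4) R) 1 0) * ((g : GL (Fin 4) R) : Matrix (Fin 4) (Fin 4) R) 2 0 +
      σ (((g : GL (Fin 4) R) : Matrix (Fin 4) (Fin 4) R) 2 0) * ((g : GL (Fin 4) R) : Matrix (Fin 4) (Fin 4) R) 1 0 +
      σ (((g : GL (Fin 4) R) : Matrix (Fin 4) (Fin 4) R) 3 0) * ((g : GL (Fin 4) R) : Matrix (Fin 4) (Fin 4) R) 0 0 = 0 := by
  have h := mem_unitaryGroupOfForm_iff.1 g.2
  have h00 := congrFun (congrFun h 0) 0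
  simp [antidiagonal_over_four, antidiagFour, Matrix.mul_apply, Fin.sum_univ_four] at h00
  linear_combination h00

/-- **column transfer**: if the `j`-th column of `p` is the first column of `g`, then the first column of `p⁻¹ g` is `e_j`. [cite: Casselman1980, §3] -/
theorem inv_mul_apply_col (p g : unitaryGroupOfForm σ ((StdForm.antidiagonal 4).over R)) (j : Fin 4)
    (hcol : ∀ i, ((p : GL (Fin 4) R) : Matrix (Fin 4) (Fin 4) R) i j = ((g : GL (Fin 4) R) : Matrix (Fin 4) (Fin 4) R) i 0) (i : Fin 4) :
    (((p⁻¹ * g : unitaryGroupOfForm σ ((StdForm.antidiagonal 4).over R)) : GL (Fin 4) R) : Matrix (Fin 4) (Fin 4) R) i 0 =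
      (1 : Matrix (Fin 4) (Fin 4) R) i j := by
  have hinv : (((p⁻¹ : unitaryGroupOfForm σ ((StdForm.antidiagonal 4).over R)) : GL (Fin 4) R) : Matrix (Fin 4) (Fin 4) R) *
      ((p : GL (Fin 4) R) : Matrix (Fin 4) (Fin 4) R) = 1 := by
    rw [Subgroup.coe_inv, ← Units.val_mul, inv_mul_cancel, Units.val_one]
  rw [Subgroup.coe_mul, Units.val_mul, Matrix.mul_apply, ← hinv, Matrix.mul_apply]
  exact Finset.sum_congr rfl fun k _ => by rw [hcol k]

/-- for `q ∈ Q` the entry `q₀₀` has the inverse `(q⁻¹)₀₀` (first column of `q⁻¹ q = 1`). [cite: Casselman1980, §3] -/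
theorem inv_apply_mul_apply_of_mem_klingen {q : unitaryGroupOfForm σ ((StdForm.antidiagonal 4).over R)} (hq : q ∈ klingen R σ) :
    (((q⁻¹ : unitaryGroupOfForm σ ((StdForm.antidiagonal 4).over R)) : GL (Fin 4) R) : Matrix (Fin 4) (Fin 4) R) 0 0 *
      ((q : GL (Fin 4) R) : Matrix (Fin 4) (Fin 4) R) 0 0 = 1 := by
  obtain ⟨h1, h2, h3⟩ := hq
  have hinv : (((q⁻¹ : unitaryGroupOfForm σ ((StdForm.antidiagonal 4).over R)) : GL (Fin 4) R) : Matrix (Fin 4) (Fin 4) R) *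
      ((q : GL (Fin 4) R) : Matrix (Fin 4) (Fin 4) R) = 1 := by
    rw [Subgroup.coe_inv, ← Units.val_mul, inv_mul_cancel, Units.val_one]
  have h00 := congrFun (congrFun hinv 0) 0
  simpa [Matrix.mul_apply, Fin.sum_univ_four, h1, h2, h3] using h00

/-- the first column of `p q` for `q ∈ Q` is `q₀₀ · (p e₀)`. [cite: Casselman1980, §3] -/
theorem mul_apply_col_zero_of_mem_klingen (p : unitaryGroupOfForm σ ((StdForm.antidiagonal 4).over R))
    {q : unitaryGroupOfForm σ ((StdForm.antidiagonal 4).over R)} (hq : q ∈ klingen R σ) (i : Fin 4) :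
    (((p * q : unitaryGroupOfForm σ ((StdForm.antidiagonal 4).over R)) : GL (Fin 4) R) : Matrix (Fin 4) (Fin 4) R) i 0 =
      ((p : GL (Fin 4) R) : Matrix (Fin 4) (Fin 4) R) i 0 * ((q : GL (Fin 4) R) : Matrix (Fin 4) (Fin 4) R) 0 0 := by
  obtain ⟨h1, h2, h3⟩ := hq
  simp [Matrix.mul_apply, Fin.sum_univ_four, h1, h2, h3]

/-- the first column of `g ξ` is the THIRD column of `g` (`ξ e₀ = e₂`). [cite: Xiong2013, §7 Lemma 7.1] -/
theorem mul_weylXi_apply_col_zero (g : unitaryGroupOfForm σ ((StdForm.antidiagonal 4).over R)) (i : Fin 4) :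
    (((g * weylXi R σ : unitaryGroupOfForm σ ((StdForm.antidiagonal 4).over R)) : GL (Fin 4) R) : Matrix (Fin 4) (Fin 4) R) i 0 =
      ((g : GL (Fin 4) R) : Matrix (Fin 4) (Fin 4) R) i 2 := by
  rw [Subgroup.coe_mul, Units.val_mul, Matrix.mul_apply, coe_weylXi]
  simp [weylXiM, Fin.sum_univ_four]

/-- the first column of `ξ⁻¹ g` vanishes below `0` as soon as the first column of `g` is `e₂`: `(ξ⁻¹ g)ᵢ₀ = δᵢ₀`. [cite: Xiong2013, §7 Lemma 7.1] -/
theorem weylXi_inv_mul_apply_col_zero (g : unitaryGroupOfForm σ ((StdForm.antidiagonal 4).over R))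
    (hg : ∀ i, ((g : GL (Fin 4) R) : Matrix (Fin 4) (Fin 4) R) i 0 = (1 : Matrix (Fin 4) (Fin 4) R) i 2) (i : Fin 4) :
    ((((weylXi R σ)⁻¹ * g : unitaryGroupOfForm σ ((StdForm.antidiagonal 4).over R)) : GL (Fin 4) R) : Matrix (Fin 4) (Fin 4) R) i 0 =
      (1 : Matrix (Fin 4) (Fin 4) R) i 0 := by
  rw [Subgroup.coe_mul, Units.val_mul, Matrix.mul_apply, coe_weylXi_inv, Fin.sum_univ_four, hg, hg, hg, hg]
  fin_cases i <;> simp [Matrix.one_apply]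

end Ring

/-! ## §2 The identity cell `P·Q`: the column test -/

section Field

variable {K : Type*} [Field K] {σ : K →+* K}

/-- a `2 × 2` completion: a nonzero column `(a, b)` is the first column of an invertible matrix. [folklore] -/
theorem exists_gl_two_col (a b : K) (h : ¬(a = 0 ∧ b = 0)) :
    ∃ A : GL (Fin 2) K, (A : Matrix (Fin 2) (Fin 2) K) 0 0 = a ∧ (A : Matrix (Fin 2) (Fin 2) K) 1 0 = b := by
  by_cases ha : a = 0
  · have hb : b ≠ 0 := fun hb => h ⟨ha, hb⟩
    refine ⟨Matrix.GeneralLinearGroup.mkOfDetNeZero !![a, 1; b, 0] ?_, rfl, rfl⟩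
    rw [Matrix.det_fin_two_of]; simpa [ha] using hb
  · refine ⟨Matrix.GeneralLinearGroup.mkOfDetNeZero !![a, 0; b, 1] ?_, rfl, rfl⟩
    rw [Matrix.det_fin_two_of]; simpa using ha

/-- **THE IDENTITY CELL**: `g ∈ P·Q ↔ g₂₀ = 0 ∧ g₃₀ = 0` (the isotropic line `g·e₀` lies in the Lagrangian `K e₀ ⊕ K e₁`).
[cite: Xiong2013, §7 Lemma 7.1] [cite: MoeglinWaldspurger1995, II.1.7] -/
theorem mem_siegel_mul_klingen_iff (hσ : ∀ x, σ (σ x) = x) (g : unitaryGroupOfForm σ ((StdForm.antidiagonal 4).over K)) :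
    (∃ p ∈ siegelFour K σ, ∃ q ∈ klingen K σ, g = p * q) ↔
      ((g : GL (Fin 4) K) : Matrix (Fin 4) (Fin 4) K) 2 0 = 0 ∧ ((g : GL (Fin 4) K) : Matrix (Fin 4) (Fin 4) K) 3 0 = 0 := by
  constructor
  · rintro ⟨p, hp, q, hq, rfl⟩
    obtain ⟨hp1, -, hp3, -⟩ := hp
    refine ⟨?_, ?_⟩ <;> rw [mul_apply_col_zero_of_mem_klingen p hq] <;> simp [hp1, hp3]
  · rintro ⟨h2, h3⟩
    -- the first column `(g₀₀, g₁₀, 0, 0)` is nonzero (`g` is invertible)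
    have hne : ¬(((g : GL (Fin 4) K) : Matrix (Fin 4) (Fin 4) K) 0 0 = 0 ∧ ((g : GL (Fin 4) K) : Matrix (Fin 4) (Fin 4) K) 1 0 = 0) := by
      rintro ⟨h0, h1⟩
      have hinv : (((g⁻¹ : unitaryGroupOfForm σ ((StdForm.antidiagonal 4).over K)) : GL (Fin 4) K) : Matrix (Fin 4) (Fin 4) K) *
          ((g : GL (Fin 4) K) : Matrix (Fin 4) (Fin 4) K) = 1 := by
        rw [Subgroup.coe_inv, ← Units.val_mul, inv_mul_cancel, Units.val_one]
      have h00 := congrFun (congrFun hinv 0) 0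
      simp [Matrix.mul_apply, Fin.sum_univ_four, h0, h1, h2, h3] at h00
    obtain ⟨A, hA0, hA1⟩ := exists_gl_two_col _ _ hne
    refine ⟨leviElt K σ hσ A, leviElt_mem_siegelFour hσ A, (leviElt K σ hσ A)⁻¹ * g, ?_, by rw [mul_inv_cancel_left]⟩
    have hcol : ∀ i, (((leviElt K σ hσ A : unitaryGroupOfForm σ _) : GL (Fin 4) K) : Matrix (Fin 4) (Fin 4) K) i 0 =
        ((g : GL (Fin 4) K) : Matrix (Fin 4) (Fin 4) K) i 0 := by
      intro i; fin_cases i <;> simp [leviM, hA0, hA1, h2, h3]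
    refine ⟨?_, ?_, ?_⟩ <;> rw [inv_mul_apply_col _ _ 0 hcol] <;> simp

/-! ## §3 The cell `P·ξ·Q` -/

/-- **THE SECOND CELL**: if `(g₂₀, g₃₀) ≠ 0` then `g ∈ P·ξ·Q`.  The skew coordinate `x = σ(g₃₀) g₀₀ + σ(g₂₀) g₁₀` of the unipotent factor satisfies `σ x = −x` exactly by
isotropy of the first column. [cite: Xiong2013, §7 Lemma 7.1] [cite: GanTakeda2011SiegelWeil, §7.2 p. 23] -/
theorem exists_siegel_weylXi_klingen (hσ : ∀ x, σ (σ x) = x) (g : unitaryGroupOfForm σ ((StdForm.antidiagonal 4).over K))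
    (h : ¬(((g : GL (Fin 4) K) : Matrix (Fin 4) (Fin 4) K) 2 0 = 0 ∧ ((g : GL (Fin 4) K) : Matrix (Fin 4) (Fin 4) K) 3 0 = 0)) :
    ∃ p ∈ siegelFour K σ, ∃ q ∈ klingen K σ, g = p * weylXi K σ * q := by
  -- the first column `c` and the skew coordinate `x`
  set c0 := ((g : GL (Fin 4) K) : Matrix (Fin 4) (Fin 4) K) 0 0 with hc0
  set c1 := ((g : GL (Fin 4) K) : Matrix (Fin 4) (Fin 4) K) 1 0 with hc1
  set c2 := ((g : GL (Fin 4) K) : Matrix (Fin 4) (Fin 4) K) 2 0 with hc2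
  set c3 := ((g : GL (Fin 4) K) : Matrix (Fin 4) (Fin 4) K) 3 0 with hc3
  have hiso : σ c0 * c3 + σ c1 * c2 + σ c2 * c1 + σ c3 * c0 = 0 := isotropic_col_zero g
  set x := σ c3 * c0 + σ c2 * c1 with hx_def
  have hx : σ x = -x := by
    have e : σ x = σ c0 * c3 + σ c1 * c2 := by rw [hx_def, map_add, map_mul, map_mul, hσ, hσ]; ring
    rw [e]; linear_combination hiso
  -- an invertible `A` with `m(A) e₂ ∝ c` on the lower block and the matching `z`: two cases
  obtain ⟨A, z, hA2, hA3, hAz0, hAz1⟩ : ∃ (A : GL (Fin 2) K) (z : K),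
      σ ((A : Matrix (Fin 2) (Fin 2) K)⁻¹ 1 1) = c2 ∧ σ ((A : Matrix (Fin 2) (Fin 2) K)⁻¹ 1 0) = c3 ∧
      (A : Matrix (Fin 2) (Fin 2) K) 0 0 * z + (A : Matrix (Fin 2) (Fin 2) K) 0 1 * x = c0 ∧
      (A : Matrix (Fin 2) (Fin 2) K) 1 0 * z + (A : Matrix (Fin 2) (Fin 2) K) 1 1 * x = c1 := by
    by_cases h2 : c2 = 0
    · -- `c₂ = 0`, `c₃ ≠ 0`: `A⁻¹ = (0 1; σc₃ 0)`, `A = (0 (σc₃)⁻¹; 1 0)`, `z = c₁`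
      have h3 : c3 ≠ 0 := fun h3 => h ⟨h2, h3⟩
      have hs3 : σ c3 ≠ 0 := fun e => h3 (by simpa [hσ] using congrArg σ e)
      have hdet : Matrix.det !![(0 : K), (σ c3)⁻¹; 1, 0] ≠ 0 := by
        rw [Matrix.det_fin_two_of]; simp [hs3]
      have hBA : !![(0 : K), 1; σ c3, 0] * !![(0 : K), (σ c3)⁻¹; 1, 0] = 1 := by
        ext i j; fin_cases i <;> fin_cases j <;> simp [Matrix.mul_apply, Fin.sum_univ_two, hs3]
      have hAinv : ((Matrix.GeneralLinearGroup.mkOfDetNeZero _ hdet : GL (Fin 2) K) : Matrix (Fin 2) (Fin 2) K)⁻¹ = !![(0 : K), 1; σ c3, 0] :=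
        Matrix.inv_eq_left_inv hBA
      refine ⟨Matrix.GeneralLinearGroup.mkOfDetNeZero _ hdet, c1, ?_, ?_, ?_, ?_⟩
      · rw [hAinv]; simp [h2]
      · rw [hAinv]; simp [hσ]
      · show (0 : K) * c1 + (σ c3)⁻¹ * x = c0
        have e : (σ c3)⁻¹ * x = c0 := by
          rw [hx_def, h2, map_zero, zero_mul, add_zero, ← mul_assoc, inv_mul_cancel₀ hs3, one_mul]
        rw [e, zero_mul, zero_add]
      · show (1 : K) * c1 + 0 * x = c1
        rw [one_mul, zero_mul, add_zero]
    · -- `c₂ ≠ 0`: `A⁻¹ = (1 0; σc₃ σc₂)`, `A = (1 0; −σc₃(σc₂)⁻¹ (σc₂)⁻¹)`, `z = c₀`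
      have hs2 : σ c2 ≠ 0 := fun e => h2 (by simpa [hσ] using congrArg σ e)
      have hdet : Matrix.det !![(1 : K), 0; -(σ c3) * (σ c2)⁻¹, (σ c2)⁻¹] ≠ 0 := by
        rw [Matrix.det_fin_two_of]; simp [hs2]
      have hBA : !![(1 : K), 0; σ c3, σ c2] * !![(1 : K), 0; -(σ c3) * (σ c2)⁻¹, (σ c2)⁻¹] = 1 := by
        ext i j; fin_cases i <;> fin_cases j <;> simp [Matrix.mul_apply, Fin.sum_univ_two, hs2]
        rw [← mul_assoc, mul_comm (σ c2), mul_assoc, mul_inv_cancel₀ hs2, mul_one, add_neg_cancel]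
      have hAinv : ((Matrix.GeneralLinearGroup.mkOfDetNeZero _ hdet : GL (Fin 2) K) : Matrix (Fin 2) (Fin 2) K)⁻¹ = !![(1 : K), 0; σ c3, σ c2] :=
        Matrix.inv_eq_left_inv hBA
      refine ⟨Matrix.GeneralLinearGroup.mkOfDetNeZero _ hdet, c0, ?_, ?_, ?_, ?_⟩
      · rw [hAinv]; simp [hσ]
      · rw [hAinv]; simp [hσ]
      · show (1 : K) * c0 + 0 * x = c0
        rw [one_mul, zero_mul, add_zero]
      · show -(σ c3) * (σ c2)⁻¹ * c0 + (σ c2)⁻¹ * x = c1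
        have e : (σ c2)⁻¹ * x = (σ c2)⁻¹ * σ c3 * c0 + c1 := by
          rw [hx_def, mul_add, ← mul_assoc, ← mul_assoc, inv_mul_cancel₀ hs2, one_mul]
        rw [e]
        ring
  -- the skew block `X = (z 0; x −σz)` and the parabolic element `p = m(A) n(X)`
  have hX : IsSkewTwo K σ !![z, 0; x, -σ z] := isSkewTwo_coords hσ x z 0 hx (by rw [map_zero, neg_zero])
  set p : unitaryGroupOfForm σ ((StdForm.antidiagonal 4).over K) := leviElt K σ hσ A * nSiegelBlk K σ hX with hp_def
  have hp : p ∈ siegelFour K σ := (siegelFour K σ).mul_mem (leviElt_mem_siegelFour hσ A) (by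
    refine ⟨?_, ?_, ?_, ?_⟩ <;> simp [nSiegelBlkM])
  -- the third column of `p` is the first column of `g`
  have hcol : ∀ i, ((p : GL (Fin 4) K) : Matrix (Fin 4) (Fin 4) K) i 2 = ((g : GL (Fin 4) K) : Matrix (Fin 4) (Fin 4) K) i 0 := by
    intro i
    rw [hp_def, Subgroup.coe_mul, Units.val_mul, coe_leviElt, coe_nSiegelBlk, Matrix.mul_apply]
    fin_cases i
    · simpa [leviM, nSiegelBlkM, Fin.sum_univ_four] using hAz0
    · simpa [leviM, nSiegelBlkM, Fin.sum_univ_four] using hAz1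
    · simpa [leviM, nSiegelBlkM, Fin.sum_univ_four] using hA2
    · simpa [leviM, nSiegelBlkM, Fin.sum_univ_four] using hA3
  -- `q := ξ⁻¹ p⁻¹ g` fixes `e₀`
  refine ⟨p, hp, (weylXi K σ)⁻¹ * (p⁻¹ * g), ?_, ?_⟩
  · have hg' : ∀ i, (((p⁻¹ * g : unitaryGroupOfForm σ _) : GL (Fin 4) K) : Matrix (Fin 4) (Fin 4) K) i 0 = (1 : Matrix (Fin 4) (Fin 4) K) i 2 :=
      inv_mul_apply_col p g 2 hcol
    refine ⟨?_, ?_, ?_⟩ <;> rw [weylXi_inv_mul_apply_col_zero _ hg'] <;> simp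
  · rw [mul_assoc p, mul_inv_cancel_left, mul_inv_cancel_left]

/-! ## §4 Disjointness and the dichotomy -/

/-- **the two cells are DISJOINT**: an element of `P·ξ·Q` has `(g₂₀, g₃₀) ≠ 0` (the lower-right block of `p ∈ P` has a left inverse, so its first column is
nonzero; `q₀₀ ≠ 0`). [cite: Xiong2013, §7 Lemma 7.1] [cite: Casselman1980, §3] -/
theorem not_col_zero_of_mem_siegel_weylXi_klingen {g p q : unitaryGroupOfForm σ ((StdForm.antidiagonal 4).over K)}
    (hp : p ∈ siegelFour K σ) (hq : q ∈ klingen K σ) (hg : g = p * weylXi K σ * q) :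
    ¬(((g : GL (Fin 4) K) : Matrix (Fin 4) (Fin 4) K) 2 0 = 0 ∧ ((g : GL (Fin 4) K) : Matrix (Fin 4) (Fin 4) K) 3 0 = 0) := by
  rintro ⟨h2, h3⟩
  -- `gᵢ₀ = pᵢ₂ · q₀₀`
  have hcol : ∀ i, ((g : GL (Fin 4) K) : Matrix (Fin 4) (Fin 4) K) i 0 =
      ((p : GL (Fin 4) K) : Matrix (Fin 4) (Fin 4) K) i 2 * ((q : GL (Fin 4) K) : Matrix (Fin 4) (Fin 4) K) 0 0 := fun i => by
    rw [hg, mul_apply_col_zero_of_mem_klingen _ hq, mul_weylXi_apply_col_zero]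
  have hq0 : ((q : GL (Fin 4) K) : Matrix (Fin 4) (Fin 4) K) 0 0 ≠ 0 := fun e => by
    have h1 := inv_apply_mul_apply_of_mem_klingen hq
    rw [e, mul_zero] at h1
    exact zero_ne_one h1
  have hp22 : ((p : GL (Fin 4) K) : Matrix (Fin 4) (Fin 4) K) 2 2 = 0 := by
    have e := hcol 2; rw [h2] at e; exact (mul_eq_zero.1 e.symm).resolve_right hq0
  have hp32 : ((p : GL (Fin 4) K) : Matrix (Fin 4) (Fin 4) K) 3 2 = 0 := by
    have e := hcol 3; rw [h3] at e; exact (mul_eq_zero.1 e.symm).resolve_right hq0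
  -- `(p⁻¹ p)₂₂ = 1` but `p⁻¹ ∈ P` and the column `(p₂₂, p₃₂) = 0`
  obtain ⟨hi1, hi2, -, -⟩ := (siegelFour K σ).inv_mem hp
  have hinv : (((p⁻¹ : unitaryGroupOfForm σ ((StdForm.antidiagonal 4).over K)) : GL (Fin 4) K) : Matrix (Fin 4) (Fin 4) K) *
      ((p : GL (Fin 4) K) : Matrix (Fin 4) (Fin 4) K) = 1 := by
    rw [Subgroup.coe_inv, ← Units.val_mul, inv_mul_cancel, Units.val_one]
  have h22 := congrFun (congrFun hinv 2) 2
  rw [Matrix.mul_apply, Fin.sum_univ_four, hi1, hi2, hp22, hp32] at h22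
  simp at h22

/-- **`P\U(J₄)(K)∕Q` HAS EXACTLY TWO ELEMENTS `{1, ξ}`**: every `g` lies in `P·Q` or in `P·ξ·Q`, and not in both. [cite: Xiong2013, §7 Lemma 7.1]
[cite: GanTakeda2011SiegelWeil, §7.2 p. 23] [cite: MoeglinWaldspurger1995, II.1.7] -/
theorem siegel_klingen_dichotomy (hσ : ∀ x, σ (σ x) = x) (g : unitaryGroupOfForm σ ((StdForm.antidiagonal 4).over K)) :
    ((∃ p ∈ siegelFour K σ, ∃ q ∈ klingen K σ, g = p * q) ∨ (∃ p ∈ siegelFour K σ, ∃ q ∈ klingen K σ, g = p * weylXi K σ * q)) ∧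
      ¬((∃ p ∈ siegelFour K σ, ∃ q ∈ klingen K σ, g = p * q) ∧ (∃ p ∈ siegelFour K σ, ∃ q ∈ klingen K σ, g = p * weylXi K σ * q)) := by
  by_cases h : ((g : GL (Fin 4) K) : Matrix (Fin 4) (Fin 4) K) 2 0 = 0 ∧ ((g : GL (Fin 4) K) : Matrix (Fin 4) (Fin 4) K) 3 0 = 0
  · refine ⟨Or.inl ((mem_siegel_mul_klingen_iff hσ g).2 h), ?_⟩
    rintro ⟨-, p, hp, q, hq, hg⟩
    exact not_col_zero_of_mem_siegel_weylXi_klingen hp hq hg h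
  · refine ⟨Or.inr (exists_siegel_weylXi_klingen hσ g h), ?_⟩
    rintro ⟨h1, -⟩
    exact h ((mem_siegel_mul_klingen_iff hσ g).1 h1)

end Field

end Summit.HodgeConjecture.HodgeConjecture.Cruxes.HLiu418.K2LiuKlingenBruhatTwoCells

end
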